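import Summits.PneNP.PneNP.Theses.PhaseTwins
import Summits.PneNP.PneNP.Theorems.PseudorandomTwinsAbove.Negative.FalseWithoutPolyTime
import Summits.PneNP.PneNP.Theorems.PhaseTwinsPseudorandomTwinsAbovePrgImageTwins
import Summits.PneNP.PneNP.Theorems.PhaseTwinsPseudorandomTwinsAboveClauseI
import Summits.PneNP.PneNP.Theorems.PhaseTwinsPseudorandomTwinsAboveConflictGraphFn
import Summits.PneNP.PneNP.Theorems.PhaseTwinsPseudorandomTwinsAboveConflictGraphGap
import Summits.PneNP.PneNP.Theorems.PhaseTwinsPseudorandomTwinsAboveDupPad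
import Summits.PneNP.PneNP.Theorems.PhaseTwinsPseudorandomTwinsAboveGapE3SATB
import Literature.Computability.Complexity.HardcoreInapproximability
import Literature.Computability.Complexity.GapAssembly
import Literature.Computability.Complexity.ApproximationProofs
import Literature.Computability.Complexity.PairProjections
import Literature.Computability.Complexity.PromiseProofs
import Literature.Computability.Complexity.KarpCliqueGadget
import Literature.Computability.Complexity.CountingHierarchyProofs
import Literature.Computability.Complexity.StringEquality
import Literature.Computability.Cryptography.PseudorandomGeneratorsAnyOWF
import Literature.Computability.Cryptography.PseudorandomnessProofs
import Literature.Computability.Cryptography.PRGStretchExtensionReduction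
import Literature.Computability.Cryptography.IndistinguishabilityPostProcessing

/-!
# `OWFExist → PseudorandomTwinsAbove` (crux stmt-PneNP-2721, route PneNP/PhaseTwins, line `prg-image-exact-threshold-lift`)

The top rung of route PhaseTwins — two polynomial-time samplable ensembles of bounded-degree graph
codes, indistinguishable by every PPT index-free test, whose hard-core counts are separated by a factor
`8` a.a.s. (`Summit.PneNP.PneNP.Theses.PhaseTwins.PseudorandomTwinsAbove`) — PROVED CONDITIONALLY on the
existence of one-way functions (`Literature.Computability.Cryptography.OWFExist`, an `@[conjecture]`
leaf of the tree; by the route's own triage every sufficient hypothesis for this crux implies the summit,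
since crux ⇒ target ⇒ `PneNP`, so a conditional theorem is the honest deliverable of the line).

THE TRANSPORT. `OWFExist` ⇒ `PRGExist` (HILL, `PRGExist_of_OWFExist`, proved in the tree) ⇒ (S1,
`stub_prgImageTwins`) PRG-image source twins `X₀ = G(U_n)` (inside the `NP` language `L = Im G`) and
`X₁ = U_{2n+1}` (in `L` with probability `→ 0`), exactly samplable, computationally indistinguishable
with the index ⇒ push BOTH through ONE map `T = f ∘ d ∘ ⟨g, id⟩ ∈ FP`: (S2a, `stub_gapE3SATB`) `g` =
Cook–Levin ∘ the tree's Dinur gap machine `GapPV.ggMachine`, whose E3-CNF output has BOUNDED variable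
occurrence (the last Dinur round ends in constant-size tester constraints over a degree-reduced graph;
`BCSP.toE3CNF` keeps occurrences bounded), satisfiable on `y ∈ L`, of value `≤ 1 - γ` on `y ∉ L`;
(S2b, `stub_dupPad`) `d` = disjoint duplication + padding to an EXACT clause count `m |y|` (shape
uniformity; gap kept up to `κ = 1/3`, occurrences kept); (S4a, `stub_conflictGraphFn`) `f` = the code of
the CONFLICT graph of the E3-CNF (one vertex per literal occurrence, edges inside a clause and between
complementary occurrences: Karp's 3SAT → INDEPENDENT SET graph); (S4b, `stub_conflictGraphGap`) its
independence number is `m · val`, its max degree `≤ B + 2`, and at `(Δ, p, q) = (B+3, 2^K, 1)` the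
hard-core count separates YES (`N ≥ 2^{Km} = 8 τ m`) from NO (`0 < N ≤ 2^{Km-3} = τ m`); ⇒ `D_b := T_* X_b`
are samplable, indistinguishable with the index (`IsCompIndistinguishable.map_fp`, proved), hence
(S5, `stub_clauseI`) `o(1)`-indistinguishable by INDEX-FREE PPT tests as clause (i) of the crux demands,
and clause (ii) holds with `t n := τ (m (ℓ n))`.

The six ingredients S1, S2a, S2b, S4a, S4b, S5 are the theorems `Summit.PneNP.PneNP.Theorems.stub_*` of
the sibling files `PhaseTwinsPseudorandomTwinsAbove{PrgImageTwins,GapE3SATB,DupPad,ConflictGraphFn,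
ConflictGraphGap,ClauseI}.lean`; this file is the composition (plus two small glue lemmas). The standing
disprover's necessary conditions (`Theorems/PseudorandomTwinsAbove/Negative/*`) are honoured: the time
bound on the tests is used (only) in S5, positivity `0 < N` is proved in S4b, both laws live on one common
length per index, and only computational (not statistical) indistinguishability is claimed.
-/

set_option linter.dupNamespace false

noncomputable section

namespace Summit.PneNP.PneNP.Theorems

open Filter
open Literature.Computability.Complexity Literature.Computability.MetaComplexity
open Literature.Computability.Cryptography (OWFExist PRGExist IsPRG IsCompIndistinguishable uniformBits
  PRGExist_of_OWFExist)
open Literature.Probability.LatticeModels (hardCoreThreshold)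
open _root_.Computability
open Summit.PneNP.PneNP.Theses.PhaseTwins (PseudorandomTwinsAbove)

/-! ## Sanity links (PROVED in the tree; nothing assumed) -/

/-- The PCP theorem in Karp form is a THEOREM of the tree (Dinur on the Gabber–Galil kit). -/
example : ∃ ε₁ : ℚ, 0 < ε₁ ∧ ε₁ ≤ 1 / 8 ∧ (gapE3SAT (1 / 8 - ε₁)).IsNPHard :=
  ⟨_, GapPV.ε₁Q_pos _, GapPV.ε₁Q_le _, gapE3SAT_isNPHard_of_gapMachine GapPV.ggMachine (GapPV.ε₁Q_le _)⟩

/-- HILL is proved in the tree: the line's hypothesis `OWFExist` already yields a PRG. -/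
example (h : OWFExist) : PRGExist := PRGExist_of_OWFExist h

open scoped Classical in
/-- The route's inlined hard-core count IS `hardcoreCount Δ p q` (definitionally). -/
example (Δ p q : ℕ) (x : List Bool) : hardcoreCount Δ p q x =
    (match encodingGraph.decode x with
      | none => 0
      | some G => if G.2.maxDegree ≤ Δ then ∑ I : Finset (Fin G.1),
          (if G.2.IsIndepSet (↑I : Set (Fin G.1)) then p ^ I.card * q ^ (G.1 - I.card) else 0) else 0) :=
  rfl

/-! ## Proved glue -/

/-- `PSamp` is closed under `FP` push-forwards (run the sampler, then the map; same coins). -/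
theorem PrgImageLift.isPolySamplable_map_fp {D : Ensemble} (hD : D.IsPolySamplable) {g : List Bool → List Bool}
    (hg : g ∈ FP) : Ensemble.IsPolySamplable fun n => (D n).map g := by
  obtain ⟨S, ⟨hS, p, hp⟩, hout⟩ := hD
  refine ⟨⟨fun n r => g (S.run n r), S.coinLen⟩, ⟨?_, p, hp⟩, fun n => ?_⟩
  · exact PolyTimeComputable.comp_holds hg hS
  · show RandAlg.outputPMF _ unaryEncodeNat n = (D n).map g
    rw [← hout n]
    simp only [RandAlg.outputPMF, PMF.map_comp]
    rfl

/-- Every natural polynomial is dominated by a power of `n + 2`. -/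
theorem PrgImageLift.poly_le_pow (s : Polynomial ℕ) : ∃ a : ℕ, ∀ n : ℕ, s.eval n ≤ (n + 2) ^ a := by
  induction s using Polynomial.induction_on' with
  | add p q hp hq =>
    obtain ⟨a, ha⟩ := hp
    obtain ⟨b, hb⟩ := hq
    refine ⟨max a b + 1, fun n => ?_⟩
    rw [Polynomial.eval_add, pow_succ]
    have h2 : 2 ≤ n + 2 := by omega
    have hpa : (n + 2) ^ a ≤ (n + 2) ^ max a b := Nat.pow_le_pow_right (by omega) (le_max_left _ _)
    have hpb : (n + 2) ^ b ≤ (n + 2) ^ max a b := Nat.pow_le_pow_right (by omega) (le_max_right _ _)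
    calc p.eval n + q.eval n ≤ (n + 2) ^ max a b + (n + 2) ^ max a b := Nat.add_le_add ((ha n).trans hpa) ((hb n).trans hpb)
      _ = (n + 2) ^ max a b * 2 := by ring
      _ ≤ (n + 2) ^ max a b * (n + 2) := Nat.mul_le_mul_left _ h2
  | monomial k c =>
    refine ⟨c + k, fun n => ?_⟩
    rw [Polynomial.eval_monomial, pow_add]
    have hc : c ≤ (n + 2) ^ c :=
      (Nat.lt_two_pow_self).le.trans (Nat.pow_le_pow_left (by omega) c)
    exact Nat.mul_le_mul hc (Nat.pow_le_pow_left (by omega) k)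

/-! ## The composition -/

/-- **`OWFExist → PseudorandomTwinsAbove`** (crux stmt-PneNP-2721 of route PneNP/PhaseTwins, conditional
on the existence of one-way functions): `OWFExist` ⇒ PRG-image source twins (S1) ⇒ one shape-uniform Karp
map `T = f ∘ d ∘ ⟨g, id⟩` (S2a, S2b, S4a) ⇒ push-forward twins, samplable and indistinguishable with the
index ⇒ the counting window (S4b) and the index-free clause (S5) ⇒ the crux BY NAME (its inlined count
and threshold are `hardcoreCount`/`hardCoreThreshold` definitionally). -/
theorem PseudorandomTwinsAbove_of_OWFExist (hOWF : OWFExist) : PseudorandomTwinsAbove := by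
  -- S0 (hypothesis) ⇒ PRG (HILL, proved) ⇒ S1: the source twins
  obtain ⟨L, ℓ, X₀, X₁, hL, hℓ, hℓpoly, hX₀, hX₁, hind, hlen₀, hlen₁, hsub, hmiss⟩ :=
    stub_prgImageTwins (PRGExist_of_OWFExist hOWF)
  -- S2a: bounded-occurrence gap E3-CNFs, and the output length of `g` in power form
  obtain ⟨g, γ, B, hg, hγ, hgspec⟩ := stub_gapE3SATB L hL
  obtain ⟨s, hs⟩ := exists_poly_length_le_of_mem_FP hg
  obtain ⟨a, ha⟩ := PrgImageLift.poly_le_pow s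
  -- S2b: the shape uniformiser; S4a: the conflict-graph code; S4b: the counting window
  obtain ⟨d, m, κ, hd, hm, hmpos, hκ, hdspec⟩ := stub_dupPad a
  obtain ⟨f, hf, hfspec⟩ := stub_conflictGraphFn
  obtain ⟨Δ, p, q, τ, len, hΔ, hq, hlam, hlenmono, hgap⟩ :=
    stub_conflictGraphGap (max B 1) (κ * γ) (mul_pos hκ hγ)
  -- the total map and its per-input specification
  set T : List Bool → List Bool := f ∘ d ∘ fanoutFn g id with hT
  have hTFP : T ∈ FP := comp_mem_FP hf (comp_mem_FP hd (fanoutFn_mem_FP hg (PolyTimeComputable.id _)))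
  have hTspec : ∀ y : List Bool, (T y).length = len (m y.length) ∧
      (y ∈ L → 8 * τ (m y.length) ≤ hardcoreCount Δ p q (T y)) ∧
      (y ∉ L → 0 < hardcoreCount Δ p q (T y) ∧ hardcoreCount Δ p q (T y) ≤ τ (m y.length)) := by
    intro y
    obtain ⟨φ, hgy, hφ3, hocc, hyes, hno⟩ := hgspec y
    have hφlen : φ.length ≤ (y.length + 2) ^ a := by
      have h1 := SatDHamRed.three_mul_length_le_length_encode φ
      have h2 := hs y
      rw [hgy] at h2
      have h3 := ha y.length
      omega
    obtain ⟨ψ, hdφ, hψ3, hψlen, hψocc, hψsat, hψval⟩ := hdspec φ y hφ3 hφlen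
    have hψpos : 0 < ψ.length := by rw [hψlen]; exact hmpos _
    have hTy : T y = f (encodingCNF.encode ψ) := by
      simp only [hT, Function.comp_apply, fanoutFn_apply, id, hgy, hdφ]
    obtain ⟨hxlen, hxyes, hxno⟩ := hgap ψ hψ3 (hψocc B hocc) hψpos (T y) (by rw [hTy, hfspec ψ])
    rw [← hψlen]
    exact ⟨hxlen, fun hy => hxyes (hψsat (hyes hy)), fun hy => hxno (hψval γ (hno hy))⟩
  -- the twins
  set D₀ : Ensemble := fun n => (X₀ n).map T with hD₀
  set D₁ : Ensemble := fun n => (X₁ n).map T with hD₁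
  set ℓ' : ℕ → ℕ := fun n => len (m (ℓ n)) with hℓ'
  have hℓ'mono : StrictMono ℓ' := hlenmono.comp (hm.comp hℓ)
  have hlen₀' : ∀ n, ∀ x ∈ (D₀ n).support, x.length = ℓ' n := by
    intro n x hx
    obtain ⟨s, hs, rfl⟩ := (PMF.mem_support_map_iff _ _ _).1 hx
    rw [(hTspec s).1, hlen₀ n s hs]
  have hlen₁' : ∀ n, ∀ x ∈ (D₁ n).support, x.length = ℓ' n := by
    intro n x hx
    obtain ⟨s, hs, rfl⟩ := (PMF.mem_support_map_iff _ _ _).1 hx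
    rw [(hTspec s).1, hlen₁ n s hs]
  -- samplable
  have hsamp₀ : D₀.IsPolySamplable := PrgImageLift.isPolySamplable_map_fp hX₀ hTFP
  have hsamp₁ : D₁.IsPolySamplable := PrgImageLift.isPolySamplable_map_fp hX₁ hTFP
  -- indistinguishable with the index (post-processing), then index-free (S5)
  set F : List Bool → List Bool := T ∘ fun z => (boolUnpair z).2 with hF
  have hFFP : F ∈ FP := comp_mem_FP hTFP boolUnpairSnd_mem_FP
  have hFT : ∀ n (s : List Bool), F (boolPair (unaryEncodeNat n) s) = T s := by
    intro n s
    simp only [hF, Function.comp_apply, boolUnpair_boolPair]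
  have hind' : IsCompIndistinguishable D₀ D₁ := by
    have hmap := IsCompIndistinguishable.map_fp (ℓ' := ℓ') hind hlen₀ hlen₁ hℓpoly hFFP
      (fun n s hs => by rw [hFT, (hTspec s).1, hs])
    have e₀ : (fun n => (X₀ n).map fun s => F (boolPair (unaryEncodeNat n) s)) = D₀ := by
      funext n
      simp only [hD₀, hFT]
    have e₁ : (fun n => (X₁ n).map fun s => F (boolPair (unaryEncodeNat n) s)) = D₁ := by
      funext n
      simp only [hD₁, hFT]
    rw [e₀, e₁] at hmap
    exact hmap
  have hi := stub_clauseI D₀ D₁ ℓ' hℓ'mono hlen₀' hlen₁' hind'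
  -- clause (ii) with the explicit threshold schedule
  set t : ℕ → ℕ := fun n => τ (m (ℓ n)) with ht
  have ha : Tendsto (fun n : ℕ => D₀.prob n {x | 8 * t n ≤ hardcoreCount Δ p q x}) atTop (nhds 1) := by
    refine tendsto_const_nhds.congr fun n => ?_
    show (1 : ℝ) = (((X₀ n).map T).toOuterMeasure {x | 8 * t n ≤ hardcoreCount Δ p q x}).toReal
    rw [PMF.toOuterMeasure_map_apply, (PMF.toOuterMeasure_apply_eq_one_iff _ _).2, ENNReal.toReal_one]
    intro s hs
    show 8 * t n ≤ hardcoreCount Δ p q (T s)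
    have h8 := (hTspec s).2.1 (hsub n s hs)
    rwa [hlen₀ n s hs] at h8
  have hb : Tendsto (fun n : ℕ => D₁.prob n {x | 0 < hardcoreCount Δ p q x ∧ hardcoreCount Δ p q x ≤ t n})
      atTop (nhds 1) := by
    have hlow : Tendsto (fun n : ℕ => 1 - X₁.prob n {s | s ∈ L}) atTop (nhds 1) := by
      simpa using (tendsto_const_nhds (x := (1 : ℝ))).sub hmiss
    refine tendsto_of_tendsto_of_tendsto_of_le_of_le hlow tendsto_const_nhds (fun n => ?_)
      (fun n => Ensemble.prob_le_one _ _ _)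
    -- `1 - Pr_{X₁ n}[L] = Pr_{X₁ n}[Lᶜ] ≤ Pr_{X₁ n}[T ⁻¹' E₁] = Pr_{D₁ n}[E₁]`
    have hcompl : 1 - X₁.prob n {s | s ∈ L} = ((X₁ n).toOuterMeasure {s | s ∈ L}ᶜ).toReal := by
      have := Summit.PneNP.PneNP.Theorems.PseudorandomTwinsAbove.Negative.mass_add_compl (X₁ n) {s | s ∈ L}
      simp only [Ensemble.prob]
      linarith
    rw [hcompl]
    show ((X₁ n).toOuterMeasure {s | s ∈ L}ᶜ).toReal ≤
      (((X₁ n).map T).toOuterMeasure {x | 0 < hardcoreCount Δ p q x ∧ hardcoreCount Δ p q x ≤ t n}).toReal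
    rw [PMF.toOuterMeasure_map_apply]
    refine ENNReal.toReal_mono
      (Summit.PneNP.PneNP.Theorems.PseudorandomTwinsAbove.Negative.toOuterMeasure_ne_top' _ _)
      (PMF.toOuterMeasure_mono _ ?_)
    rintro s ⟨hsL, hs⟩
    have hsL' : s ∉ L := fun h' => hsL h'
    show 0 < hardcoreCount Δ p q (T s) ∧ hardcoreCount Δ p q (T s) ≤ t n
    have h8 := (hTspec s).2.2 hsL'
    rwa [hlen₁ n s hs] at h8
  -- the crux, by name (its inlined count/threshold are `hardcoreCount`/`hardCoreThreshold`, `rfl`)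
  exact ⟨Δ, p, q, hΔ, hq, hlam, D₀, D₁, hsamp₀, hsamp₁, hi, t, ha, hb⟩

end Summit.PneNP.PneNP.Theorems

end
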